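import Summits.ABC.StewartYu.ArchG3RecLinesHCore
import HarnessLib

/-!
# The archimedean record `ArchG3Rec` — letter lines in closed form, H family (half step): CORE BOUNDS, file B

Support file (theorems only; no named facts). Cell `abc-stewartyu`, route `YuMatveevShapeRat`, crux r2 `ArchCoreRat` (stmt-ABC-20502),
line `arch-g3-frame`, seam (B) of `stub_recLinesArch`, plan R50 (the half-step family `HalfStepLinesK (2^(n−1)) c lev` is seat p5's).
Continuation of `ArchG3RecLinesHCore` (currency `X·L`):
* `gamma_zero_le` / `gamma_succ_le` / `gamma_le` (slab centre/width against the node counts, both regimes),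
  `wl_rhoF_le` (`wl·ρ_F ≤ 0.42·2ⁿ·X·L`, `e^{−(G+2)}·e^{G} = e^{−2}`);
(`cb_logs_le` / `small_prod_le` / `Tsucc_le` / `Tcost_le` are in `ArchG3RecLinesHCoreC`.)

## References
* [Nesterenko2003] Yu. V. Nesterenko, LNM 1819 (2003) — §4 (4.3)–(4.5), §4.3 (4.36)–(4.51); shape only.
-/

noncomputable section

open Finset Real
open scoped Nat

namespace Summit.ABC.StewartYu

namespace ArchG3Rec

open PadicG3Par (Cb Cb_pos)
open ArchG3Par (G K yloadK G_eq G_pos K_pos yloadK_pos eight_le_G one_le_K)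

variable {n : ℕ} (P : ArchG3Rec n)

/-! ### The slab at the half step -/

/-- **the slab at the half step, level `0`**: `γb 0·(3Nf+2) ≤ (31/40)·n·2ⁿXL + 2ⁿXL/2^16`,
`2ⁿ(γb 0 + wl 0)·Nh 1 ≤ (51/100)·n·2ⁿXL + 2ⁿXL/2^16`, `wl 0·(3Nf+2) ≤ 2ⁿXL/2^16`. [cite: Matveev2000, §3; shape only] -/
theorem gamma_zero_le :
    P.γb 0 * (3 * (P.Nf 0 n : ℝ) + 2) ≤ 31 / 40 * n * (2 ^ n * ((P.X : ℝ) * P.L)) + 2 ^ n * ((P.X : ℝ) * P.L) / 2 ^ 16 ∧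
    2 ^ n * ((P.γb 0 + P.wl 0) * P.Nh (0 + 1)) ≤ 51 / 100 * n * (2 ^ n * ((P.X : ℝ) * P.L)) + 2 ^ n * ((P.X : ℝ) * P.L) / 2 ^ 16 ∧
    P.wl 0 * (3 * (P.Nf 0 n : ℝ) + 2) ≤ 2 ^ n * ((P.X : ℝ) * P.L) / 2 ^ 16 := by
  obtain ⟨hNf, hNh, -, -⟩ := P.nodes_half_le 0
  rw [pow_zero, one_mul] at hNf hNh
  obtain ⟨h0, -, -, -⟩ := P.γb_facts 0
  obtain ⟨hwX, hw, hw0⟩ := P.wl_X_le 0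
  have hX : (128 : ℝ) ≤ P.X := P.X_floors.2.1
  have hL := P.L_real.2.1
  have hn0 : (0 : ℝ) ≤ n := Nat.cast_nonneg n
  have h2n : (1 : ℝ) ≤ 2 ^ n := one_le_pow₀ (by norm_num)
  have h2n0 : (0 : ℝ) ≤ 2 ^ n := by positivity
  set XL : ℝ := (P.X : ℝ) * P.L with hXLdef
  have hXL0 : 0 < XL := by positivity
  -- the two node factors
  have hA : 3 * (P.Nf 0 n : ℝ) + 2 ≤ 2 ^ n * (3 / 2 * P.X + 5) := by nlinarith
  have hA0 : (0 : ℝ) ≤ 3 * (P.Nf 0 n : ℝ) + 2 := by positivity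
  -- `wl 0 · (3/2 X + 5) ≤ 2·XL/2^18`, `(nL/2)(3/2 X + 5) ≤ (31/40) n XL`
  have hW : P.wl 0 * (3 / 2 * (P.X : ℝ) + 5) ≤ XL / 2 ^ 16 := by nlinarith
  have hNLX : (n : ℝ) * P.L * 5 ≤ (n : ℝ) * XL / 25 := by
    rw [hXLdef, le_div_iff₀ (by norm_num)]; nlinarith [mul_nonneg hn0 hL.le]
  have hC : (n : ℝ) * P.L / 2 * (3 / 2 * (P.X : ℝ) + 5) ≤ 31 / 40 * n * XL := by
    have : (n : ℝ) * P.L / 2 * (3 / 2 * (P.X : ℝ) + 5) = 3 / 4 * (n * XL) + (n : ℝ) * P.L * 5 / 2 := by rw [hXLdef]; ring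
    rw [this]; nlinarith [mul_nonneg hn0 hXL0.le]
  refine ⟨?_, ?_, ?_⟩
  · -- `γb 0 · (3Nf+2) ≤ (nL/2 + wl 0)·2ⁿ(3/2 X + 5)`
    rw [h0]
    have h1 : ((n : ℝ) * P.L / 2 + P.wl 0) * (3 * (P.Nf 0 n : ℝ) + 2) ≤ ((n : ℝ) * P.L / 2 + P.wl 0) * (2 ^ n * (3 / 2 * P.X + 5)) :=
      mul_le_mul_of_nonneg_left hA (by positivity)
    have h2 : ((n : ℝ) * P.L / 2 + P.wl 0) * (2 ^ n * (3 / 2 * (P.X : ℝ) + 5)) =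
        2 ^ n * ((n : ℝ) * P.L / 2 * (3 / 2 * (P.X : ℝ) + 5) + P.wl 0 * (3 / 2 * (P.X : ℝ) + 5)) := by ring
    rw [h2] at h1
    have h3 : 2 ^ n * ((n : ℝ) * P.L / 2 * (3 / 2 * (P.X : ℝ) + 5) + P.wl 0 * (3 / 2 * (P.X : ℝ) + 5)) ≤
        2 ^ n * (31 / 40 * n * XL + XL / 2 ^ 16) := mul_le_mul_of_nonneg_left (by linarith) h2n0
    have h4 : 2 ^ n * (31 / 40 * n * XL + XL / 2 ^ 16) = 31 / 40 * n * (2 ^ n * XL) + 2 ^ n * XL / 2 ^ 16 := by ring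
    linarith
  · rw [h0]
    have hNh0 : (0 : ℝ) ≤ P.Nh (0 + 1) := Nat.cast_nonneg _
    have h1 : ((n : ℝ) * P.L / 2 + P.wl 0 + P.wl 0) * (P.Nh (0 + 1) : ℝ) ≤ ((n : ℝ) * P.L / 2 + 2 * P.wl 0) * (P.X + 1) := by
      have := mul_le_mul_of_nonneg_left hNh (by positivity : (0:ℝ) ≤ (n : ℝ) * P.L / 2 + 2 * P.wl 0)
      linarith
    have h2 : ((n : ℝ) * P.L / 2 + 2 * P.wl 0) * ((P.X : ℝ) + 1) ≤ 51 / 100 * n * XL + XL / 2 ^ 16 := by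
      have h3 : ((n : ℝ) * P.L / 2 + 2 * P.wl 0) * ((P.X : ℝ) + 1) = (n : ℝ) * XL / 2 + (n : ℝ) * P.L / 2 + 2 * (P.wl 0 * P.X) + 2 * P.wl 0 := by
        rw [hXLdef]; ring
      rw [h3]
      have h4 : (n : ℝ) * P.L / 2 ≤ (n : ℝ) * XL / 256 := by
        rw [hXLdef, div_le_div_iff₀ (by norm_num) (by norm_num)]; nlinarith [mul_nonneg hn0 hL.le]
      nlinarith [mul_nonneg hn0 hXL0.le]
    calc 2 ^ n * (((n : ℝ) * P.L / 2 + P.wl 0 + P.wl 0) * (P.Nh (0 + 1) : ℝ))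
        ≤ 2 ^ n * (51 / 100 * n * XL + XL / 2 ^ 16) := mul_le_mul_of_nonneg_left (h1.trans h2) h2n0
      _ = 51 / 100 * n * (2 ^ n * XL) + 2 ^ n * XL / 2 ^ 16 := by ring
  · have h1 : P.wl 0 * (3 * (P.Nf 0 n : ℝ) + 2) ≤ P.wl 0 * (2 ^ n * (3 / 2 * P.X + 5)) := mul_le_mul_of_nonneg_left hA hw0
    have h2 : P.wl 0 * (2 ^ n * (3 / 2 * (P.X : ℝ) + 5)) = 2 ^ n * (P.wl 0 * (3 / 2 * (P.X : ℝ) + 5)) := by ring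
    rw [h2] at h1
    have h3 := mul_le_mul_of_nonneg_left hW h2n0
    have h4 : 2 ^ n * (XL / 2 ^ 16) = 2 ^ n * XL / 2 ^ 16 := by ring
    linarith

/-- **the slab at the half step, level `l+1`**: there the centre is the re-centred `wl l/2 = wl (l+1)` and all three products are
`≤ 2ⁿXL/2^16`. [cite: Matveev2000, §3; shape only] -/
theorem gamma_succ_le (l : ℕ) :
    P.γb (l + 1) * (3 * (P.Nf (l + 1) n : ℝ) + 2) ≤ 2 ^ n * ((P.X : ℝ) * P.L) / 2 ^ 16 ∧
    2 ^ n * ((P.γb (l + 1) + P.wl (l + 1)) * P.Nh (l + 1 + 1)) ≤ 2 ^ n * ((P.X : ℝ) * P.L) / 2 ^ 16 ∧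
    P.wl (l + 1) * (3 * (P.Nf (l + 1) n : ℝ) + 2) ≤ 2 ^ n * ((P.X : ℝ) * P.L) / 2 ^ 16 := by
  obtain ⟨hNf, hNh, -, -⟩ := P.nodes_half_le (l + 1)
  obtain ⟨hwl, -⟩ := P.wl_facts l
  obtain ⟨-, -, -, -, -, hγ⟩ := P.slab_real l
  obtain ⟨hw0, hw, -, hγ0, -, -⟩ := P.slab_real (l + 1)
  obtain ⟨he, -, -⟩ := exp_consts P.hn
  have hX : (128 : ℝ) ≤ P.X := P.X_floors.2.1
  have hL := P.L_real.2.1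
  have h2n : (1 : ℝ) ≤ 2 ^ n := one_le_pow₀ (by norm_num)
  have h2n0 : (0 : ℝ) ≤ 2 ^ n := by positivity
  have h2l : (1 : ℝ) ≤ 2 ^ l := one_le_pow₀ (by norm_num)
  set XL : ℝ := (P.X : ℝ) * P.L with hXLdef
  set ε : ℝ := Real.exp (-(G n + 2)) with hεdef
  have hε0 : 0 ≤ ε := (Real.exp_pos _).le
  -- `wl(l+1)·2^{l+1} = L·ε`, so `wl(l+1)·2^l·X = LεX/2`, `wl(l+1) ≤ Lε/2`
  have hw2 : P.wl (l + 1) * 2 ^ (l + 1) = (P.L : ℝ) * ε := by rw [hw]; field_simp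
  have hwX : P.wl (l + 1) * (2 ^ l * (P.X : ℝ)) = (P.L : ℝ) * ε * P.X / 2 := by
    have : P.wl (l + 1) * (2 ^ l * (P.X : ℝ)) = (P.wl (l + 1) * 2 ^ (l + 1)) * P.X / 2 := by rw [pow_succ]; ring
    rw [this, hw2]
  have hwle : P.wl (l + 1) ≤ (P.L : ℝ) * ε / 2 := by
    rw [le_div_iff₀ (by norm_num), ← hw2, pow_succ]
    have := mul_le_mul_of_nonneg_left h2l hw0
    nlinarith
  have hLεX : (P.L : ℝ) * ε * P.X ≤ XL / 2 ^ 18 := by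
    rw [hXLdef]
    have := mul_le_mul_of_nonneg_left he (by positivity : (0:ℝ) ≤ (P.L : ℝ) * P.X)
    have h' : (P.L : ℝ) * P.X * (1 / 2 ^ 18) = P.X * P.L / 2 ^ 18 := by ring
    nlinarith
  have hLε : (P.L : ℝ) * ε ≤ XL / 2 ^ 25 := by
    have h1 : (P.L : ℝ) * ε * 128 ≤ (P.L : ℝ) * ε * P.X := mul_le_mul_of_nonneg_left hX (by positivity)
    have h2 : XL / 2 ^ 18 = XL / 2 ^ 25 * 128 := by ring
    nlinarith
  have hγw : P.γb (l + 1) ≤ 2 * P.wl (l + 1) := by rw [hwl]; linarith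
  -- `wl·(3Nf+2) ≤ 3·2ⁿ·(LεX/2) + wl·(3·2ⁿ+2) ≤ 2ⁿ·(3/2·LεX + 5/2·Lε)`
  have hprod : P.wl (l + 1) * (3 * (P.Nf (l + 1) n : ℝ) + 2) ≤ 2 ^ n * (3 / 2 * ((P.L : ℝ) * ε * P.X) + 5 / 2 * ((P.L : ℝ) * ε)) := by
    have h1 : P.wl (l + 1) * (3 * (P.Nf (l + 1) n : ℝ) + 2) ≤ P.wl (l + 1) * (3 * (2 ^ n * (2 ^ (l + 1) * P.X / 2 + 1)) + 2) :=
      mul_le_mul_of_nonneg_left (by linarith) hw0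
    have h2 : P.wl (l + 1) * (3 * (2 ^ n * (2 ^ (l + 1) * (P.X : ℝ) / 2 + 1)) + 2) =
        3 * 2 ^ n * (P.wl (l + 1) * (2 ^ l * P.X)) + P.wl (l + 1) * (3 * 2 ^ n + 2) := by rw [pow_succ]; ring
    rw [h2, hwX] at h1
    have h3 : P.wl (l + 1) * (3 * 2 ^ n + 2) ≤ (P.L : ℝ) * ε / 2 * (5 * 2 ^ n) := by
      have := mul_le_mul hwle (by linarith : (3 : ℝ) * 2 ^ n + 2 ≤ 5 * 2 ^ n) (by positivity) (by positivity)
      linarith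
    have h4 : 3 * 2 ^ n * ((P.L : ℝ) * ε * P.X / 2) + (P.L : ℝ) * ε / 2 * (5 * 2 ^ n) =
        2 ^ n * (3 / 2 * ((P.L : ℝ) * ε * P.X) + 5 / 2 * ((P.L : ℝ) * ε)) := by ring
    linarith
  have hin : 3 / 2 * ((P.L : ℝ) * ε * P.X) + 5 / 2 * ((P.L : ℝ) * ε) ≤ XL / 2 ^ 16 / 2 := by linarith
  have hmain : 2 ^ n * (3 / 2 * ((P.L : ℝ) * ε * P.X) + 5 / 2 * ((P.L : ℝ) * ε)) ≤ 2 ^ n * XL / 2 ^ 16 / 2 := by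
    have := mul_le_mul_of_nonneg_left hin h2n0
    have h' : 2 ^ n * (XL / 2 ^ 16 / 2) = 2 ^ n * XL / 2 ^ 16 / 2 := by ring
    linarith
  have hPos : 0 ≤ 2 ^ n * XL / 2 ^ 16 := by positivity
  refine ⟨?_, ?_, by linarith⟩
  · calc P.γb (l + 1) * (3 * (P.Nf (l + 1) n : ℝ) + 2) ≤ 2 * P.wl (l + 1) * (3 * (P.Nf (l + 1) n : ℝ) + 2) :=
          mul_le_mul_of_nonneg_right hγw (by positivity)
      _ = 2 * (P.wl (l + 1) * (3 * (P.Nf (l + 1) n : ℝ) + 2)) := by ring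
      _ ≤ 2 ^ n * XL / 2 ^ 16 := by linarith
  · -- `(γb+wl)·Nh ≤ 3wl·(2^{l+1}X + 1) = 3 LεX + 3wl`
    have h1 : (P.γb (l + 1) + P.wl (l + 1)) * (P.Nh (l + 1 + 1) : ℝ) ≤ 3 * P.wl (l + 1) * (2 ^ (l + 1) * P.X + 1) :=
      calc (P.γb (l + 1) + P.wl (l + 1)) * (P.Nh (l + 1 + 1) : ℝ) ≤ (3 * P.wl (l + 1)) * (P.Nh (l + 1 + 1) : ℝ) :=
            mul_le_mul_of_nonneg_right (by linarith) (by positivity)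
        _ ≤ 3 * P.wl (l + 1) * (2 ^ (l + 1) * P.X + 1) := mul_le_mul_of_nonneg_left hNh (by positivity)
    have h2 : 3 * P.wl (l + 1) * (2 ^ (l + 1) * (P.X : ℝ) + 1) = 3 * ((P.L : ℝ) * ε * P.X) + 3 * P.wl (l + 1) := by
      have : 3 * P.wl (l + 1) * (2 ^ (l + 1) * (P.X : ℝ) + 1) = 3 * (P.wl (l + 1) * 2 ^ (l + 1)) * P.X + 3 * P.wl (l + 1) := by ring
      rw [this, hw2]; ring
    rw [h2] at h1
    have h3 : 3 * ((P.L : ℝ) * ε * P.X) + 3 * P.wl (l + 1) ≤ XL / 2 ^ 16 := by linarith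
    calc 2 ^ n * ((P.γb (l + 1) + P.wl (l + 1)) * (P.Nh (l + 1 + 1) : ℝ)) ≤ 2 ^ n * (XL / 2 ^ 16) :=
          mul_le_mul_of_nonneg_left (h1.trans h3) h2n0
      _ = 2 ^ n * XL / 2 ^ 16 := by ring

/-- **the slab at the half step (both regimes)**: `γb lev·(3Nf+2) ≤ (31/40)·n·2ⁿXL + 2ⁿXL/2^16`,
`2ⁿ(γb lev + wl lev)·Nh(lev+1) ≤ (51/100)·n·2ⁿXL + 2ⁿXL/2^16`, `wl lev·(3Nf+2) ≤ 2ⁿXL/2^16`, `0 ≤ γb, wl`.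
[cite: Matveev2000, §3; shape only] -/
theorem gamma_le (lev : ℕ) :
    P.γb lev * (3 * (P.Nf lev n : ℝ) + 2) ≤ 31 / 40 * n * (2 ^ n * ((P.X : ℝ) * P.L)) + 2 ^ n * ((P.X : ℝ) * P.L) / 2 ^ 16 ∧
    2 ^ n * ((P.γb lev + P.wl lev) * P.Nh (lev + 1)) ≤ 51 / 100 * n * (2 ^ n * ((P.X : ℝ) * P.L)) + 2 ^ n * ((P.X : ℝ) * P.L) / 2 ^ 16 ∧
    P.wl lev * (3 * (P.Nf lev n : ℝ) + 2) ≤ 2 ^ n * ((P.X : ℝ) * P.L) / 2 ^ 16 ∧ 0 ≤ P.γb lev ∧ 0 ≤ P.wl lev := by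
  obtain ⟨hw0, -, -, hγ0, -, -⟩ := P.slab_real lev
  have hn1 : (1 : ℝ) ≤ n := by exact_mod_cast P.hn
  have hP : 0 ≤ 2 ^ n * ((P.X : ℝ) * P.L) := by positivity
  rcases Nat.eq_zero_or_pos lev with rfl | hlev
  · obtain ⟨h1, h2, h3⟩ := P.gamma_zero_le
    exact ⟨h1, h2, h3, hγ0, hw0⟩
  · obtain ⟨l, rfl⟩ : ∃ l, lev = l + 1 := ⟨lev - 1, by omega⟩
    obtain ⟨h1, h2, h3⟩ := P.gamma_succ_le l
    have hnP : 0 ≤ (n : ℝ) * (2 ^ n * ((P.X : ℝ) * P.L)) := mul_nonneg (by linarith) hP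
    refine ⟨h1.trans ?_, h2.trans ?_, h3, hγ0, hw0⟩
    · linarith
    · linarith

/-- **the slab width against the growth radius**: `wl lev·((3e^G+1)(2Nf+1) + Nf) ≤ 0.42·2ⁿ·X·L`
(`e^{−(G+2)}·(3e^G+1) = 3e^{−2} + e^{−(G+2)} ≤ 0.4063`, `2Nf+1 ≤ 2^lev·2ⁿ·(X+3)`). [cite: Nesterenko2003, §4.3 (4.44); shape only] -/
theorem wl_rhoF_le (lev : ℕ) :
    P.wl lev * ((3 * Real.exp (G n) + 1) * (2 * (P.Nf lev n : ℝ) + 1) + P.Nf lev n) ≤ 42 / 100 * (2 ^ n * ((P.X : ℝ) * P.L)) := by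
  obtain ⟨hNf, -, hNf1, -⟩ := P.nodes_half_le lev
  obtain ⟨hw0, hw, -, -, -, -⟩ := P.slab_real lev
  obtain ⟨he, he2, hee⟩ := exp_consts P.hn
  have hX : (128 : ℝ) ≤ P.X := P.X_floors.2.1
  have hL := P.L_real.2.1
  have h2n : (1 : ℝ) ≤ 2 ^ n := one_le_pow₀ (by norm_num)
  have h2l : (1 : ℝ) ≤ 2 ^ lev := one_le_pow₀ (by norm_num)
  have h2l0 : (0 : ℝ) < 2 ^ lev := by positivity
  set ε : ℝ := Real.exp (-(G n + 2)) with hεdef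
  have hε0 : 0 ≤ ε := (Real.exp_pos _).le
  have hG0 : 0 ≤ Real.exp (G n) := (Real.exp_pos _).le
  have hNf0 : (0 : ℝ) ≤ P.Nf lev n := by linarith
  -- `ε·ρF = (3e^{-2} + ε)(2Nf+1) + ε Nf ≤ 0.4063·(2Nf+1)`
  have h1 : ε * ((3 * Real.exp (G n) + 1) * (2 * (P.Nf lev n : ℝ) + 1) + P.Nf lev n) ≤ 4063 / 10000 * (2 * (P.Nf lev n : ℝ) + 1) := by
    have h2 : ε * ((3 * Real.exp (G n) + 1) * (2 * (P.Nf lev n : ℝ) + 1) + P.Nf lev n) =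
        (3 * (ε * Real.exp (G n)) + ε) * (2 * (P.Nf lev n : ℝ) + 1) + ε * P.Nf lev n := by ring
    rw [h2, hee]
    have h3 : ε * (P.Nf lev n : ℝ) ≤ 1 / 2 ^ 18 * (2 * (P.Nf lev n : ℝ) + 1) := by nlinarith
    have h4 : (3 * Real.exp (-2 : ℝ) + ε) * (2 * (P.Nf lev n : ℝ) + 1) ≤ (3 * (1354 / 10000) + 1 / 2 ^ 18) * (2 * (P.Nf lev n : ℝ) + 1) :=
      mul_le_mul_of_nonneg_right (by linarith) (by linarith)
    nlinarith
  -- `2Nf+1 ≤ 2^lev·2ⁿ·(X+3)`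
  have h3 : 2 * (P.Nf lev n : ℝ) + 1 ≤ 2 ^ lev * (2 ^ n * ((P.X : ℝ) + 3)) := by
    have h4 : 2 * (P.Nf lev n : ℝ) + 1 ≤ 2 ^ lev * (2 ^ n * P.X) + (2 * 2 ^ n + 1) := by nlinarith
    have h5 : (2 : ℝ) * 2 ^ n + 1 ≤ 2 ^ lev * (2 ^ n * 3) := by nlinarith [mul_le_mul h2l h2n zero_le_one (by positivity)]
    nlinarith
  -- assemble: `wl·ρF = (L/2^lev)·(ε·ρF)`
  have h4 : P.wl lev * ((3 * Real.exp (G n) + 1) * (2 * (P.Nf lev n : ℝ) + 1) + P.Nf lev n) =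
      (P.L : ℝ) / 2 ^ lev * (ε * ((3 * Real.exp (G n) + 1) * (2 * (P.Nf lev n : ℝ) + 1) + P.Nf lev n)) := by
    rw [hw]; ring
  rw [h4]
  have h5 : (P.L : ℝ) / 2 ^ lev * (ε * ((3 * Real.exp (G n) + 1) * (2 * (P.Nf lev n : ℝ) + 1) + P.Nf lev n)) ≤
      (P.L : ℝ) / 2 ^ lev * (4063 / 10000 * (2 ^ lev * (2 ^ n * ((P.X : ℝ) + 3)))) := by
    refine mul_le_mul_of_nonneg_left (h1.trans ?_) (by positivity)
    exact mul_le_mul_of_nonneg_left h3 (by norm_num)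
  have h6 : (P.L : ℝ) / 2 ^ lev * (4063 / 10000 * (2 ^ lev * (2 ^ n * ((P.X : ℝ) + 3)))) =
      4063 / 10000 * (2 ^ n * (P.L * ((P.X : ℝ) + 3))) := by
    field_simp
  rw [h6] at h5
  have h7 : (P.L : ℝ) * ((P.X : ℝ) + 3) ≤ 1031 / 1000 * ((P.X : ℝ) * P.L) := by nlinarith
  have h8 := mul_le_mul_of_nonneg_left h7 (by positivity : (0:ℝ) ≤ 2 ^ n)
  nlinarith

end ArchG3Rec

end Summit.ABC.StewartYu

end
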